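import Summits.KontsevichZagierPeriods.KontsevichZagierPeriods.Theorems.LinRedNormalFormArrangementNormalFormSeparateHighFanPos
import Summits.KontsevichZagierPeriods.KontsevichZagierPeriods.Theorems.LinRedNormalFormArrangementNormalFormSeparateHighFree

/-!
# `stub_separateHigh` when the convergence is not bought by the numerator, no flats hypothesis

(Line `janus-bands`, crux `ArrangementNormalForm`, stubs `stub_separateHigh` /
`stub_separateThreeZero` — separation in base dimension `≥ 3`; part `FanFree` (registered as
`separateHigh_fanFree`), valid in every base dimension `B + 2 ≥ 2`.)

**Theorem** (`separateHigh_fanFree`). A Janus band representation `s` over the base `ℝ^{B+2}`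
with `k` fibres (literal `JJ (B+2) k` data: letters `L, e`, numerator `P`, fibre block `Φ`, on
a bounded rational cell `σ`) whose NUMERATOR-FREE integrand `∏ Lⱼ^{−eⱼ} · Φ` is absolutely
integrable on `σ` is congruent modulo `KZ.relations` to a `ℤ`-combination of elements of
`GG (B+1) 1 k`.

This supersedes `separateHigh_of_flatsDisjoint_free` (no hypothesis on the codimension-2 flats
any more) and reduces the registered stubs `stub_separateHigh` / `stub_separateThreeZero` to the
data whose convergence is bought by the zeros of `P` on the closed cell (the numerator split
`GG♮ → GG`, cf. `separateHigh_natural`). Proof (rule 1b, as in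
`separateHigh_of_flatsDisjoint_free`): `[s] = [σ, (P + K) R Φ] − [σ, K R Φ]` for a rational
constant `K > sup_σ |P|` (`SepHigh.exists_bound_aeval`); both auxiliary representations exist by
the integrability hypothesis and have numerators bounded away from zero, so
`separateHigh_fanPos` applies to each.
-/

noncomputable section

open Set MeasureTheory MvPolynomial

namespace Summit.KontsevichZagierPeriods.ArrangementNormalForm.JanusBands

open Literature.NumberTheory.Transcendental Literature.ModelTheory.ExponentialFields

open SeparatePos SepHigh in
/-- **`stub_separateHigh`, convergence not bought by the numerator** (registered part
`separateHigh_fanFree` of `stub_separateHigh`; every base dimension `B + 2 ≥ 2`, no hypothesis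
on the flats of the letters): a Janus band representation over `ℝ^{B+2}` with `k` fibres whose
numerator-free integrand `∏ Lⱼ^{−eⱼ} · (fibre block)` is absolutely integrable on the domain is
congruent modulo `KZ.relations` to a `ℤ`-combination of elements of `GG (B+1) 1 k`; see the
module docstring. [Kontsevich–Zagier 2001, §1.2] -/
theorem separateHigh_fanFree (GG : ℕ → ℕ → ℕ → Set KZ.FormalRep) (hGG : ∀ b σ k, GG b σ k = {w : KZ.FormalRep | ∃ (m m' n₁ n₂ : ℕ) (s : KZ.IntegralRep (b + 1 + k)) (M : Fin m' → (Fin (b + 1) → ℚ) × ℚ) (L : Fin m → (Fin b → ℚ) × ℚ) (e : Fin m → ℕ) (p : MvPolynomial (Fin b) ℚ) (ℓ₁ ℓ₂ : (Fin b → ℚ) × ℚ) (a : Fin k → Option ((Fin (b + 1) → ℚ) × ℚ)) (lo hi : Fin k → Fin k ⊕ ((Fin (b + 1) → ℚ) × ℚ)), (n₁ = 0 ∨ n₂ = 0) ∧ (σ = 2 → (∀ i c, a i = some c → c.1 (Fin.last b) = 0) ∧ (∀ i c, (lo i = Sum.inr c ∨ hi i = Sum.inr c) → (c.1 (Fin.last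 b) = 0 ∨ c = (Pi.single (Fin.last b) 1, 0)))) ∧ Bornology.IsBounded s.domain ∧ s.domain = {z | (∀ j, 0 < ∑ i, ((M j).1 i : ℝ) * z (Fin.castAdd k i) + ((M j).2 : ℝ)) ∧ ∀ i, Sum.elim (fun j => z (Fin.natAdd (b + 1) j)) (fun c => ∑ i', (c.1 i' : ℝ) * z (Fin.castAdd k i') + (c.2 : ℝ)) (lo i) < z (Fin.natAdd (b + 1) i) ∧ z (Fin.natAdd (b + 1) i) < Sum.elim (fun j => z (Fin.natAdd (b + 1) j)) (fun c => ∑ i', (c.1 i' : ℝ) * z (Fin.castAdd k i') + (c.2 : ℝ)) (hi i)} ∧ EqOn s.integrand (fun z => MvPolynomial.aeval (fun i => z (Fin.castAdd k (Fin.castSucc i))) p / (∏ j, (∑ i, ((L j).1 i : ℝ) * z (Fin.castAdd k (Fin.castSucc i)) + ((L j).2 : ℝ)) ^ e j) * ((z (Fin.castAdd k (Fin.last b)) - (∑ i, (ℓ₁.1 i : ℝ) * z (Fin.castAdd k (Fin.castSucc i)) + (ℓ₁.2 : ℝ))) ^ n₁ / (z (Fin.castAdd k (Fin.last b)) - (∑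 i, (ℓ₂.1 i : ℝ) * z (Fin.castAdd k (Fin.castSucc i)) + (ℓ₂.2 : ℝ))) ^ n₂) * ∏ i, (a i).elim 1 (fun c => 1 / (z (Fin.natAdd (b + 1) i) - (∑ i', (c.1 i' : ℝ) * z (Fin.castAdd k i') + (c.2 : ℝ))))) s.domain ∧ w = KZ.of s}) (B k m m' : ℕ) (s : KZ.IntegralRep (B + 2 + k)) (M : Fin m' → (Fin (B + 2) → ℚ) × ℚ) (L : Fin m → (Fin (B + 2) → ℚ) × ℚ) (e : Fin m → ℕ) (p : MvPolynomial (Fin (B + 2)) ℚ) (a : Fin k → Option ((Fin (B + 2) → ℚ) × ℚ)) (lo hi : Fin k → Fin k ⊕ ((Fin (B + 2) → ℚ) × ℚ)) (hbd : Bornology.IsBounded s.domain) (hdom : s.domain = {z | (∀ j, 0 < ∑ i, ((M j).1 i : ℝ) * z (Fin.castAdd k i) + ((M j).2 : ℝ)) ∧ ∀ i, Sum.elim (fun j => z (Fin.natAdd (B + 2) j)) (fun c => ∑ i', (c.1 i' : ℝ) * z (Fin.castAdd k i') + (c.2 : ℝ)) (lo i) < z (Fin.natAdd (B + 2) i) ∧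 z (Fin.natAdd (B + 2) i) < Sum.elim (fun j => z (Fin.natAdd (B + 2) j)) (fun c => ∑ i', (c.1 i' : ℝ) * z (Fin.castAdd k i') + (c.2 : ℝ)) (hi i)}) (hint : EqOn s.integrand (fun z => MvPolynomial.aeval (fun i => z (Fin.castAdd k i)) p / (∏ j, (∑ i, ((L j).1 i : ℝ) * z (Fin.castAdd k i) + ((L j).2 : ℝ)) ^ e j) * ∏ i, (a i).elim 1 (fun c => 1 / (z (Fin.natAdd (B + 2) i) - (∑ i', (c.1 i' : ℝ) * z (Fin.castAdd k i') + (c.2 : ℝ))))) s.domain) (hfree : IntegrableOn (fun z => (∏ j, (∑ i, ((L j).1 i : ℝ) * z (Fin.castAdd k i) + ((L j).2 : ℝ)) ^ e j)⁻¹ * ∏ i, (a i).elim 1 (fun c => 1 / (z (Fin.natAdd (B + 2) i) - (∑ i', (c.1 i' : ℝ) * z (Fin.castAdd k i') + (c.2 : ℝ))))) s.domain) : ∃ c ∈ AddSubgroup.closure (GG (B + 1) 1 k), KZ.of s - c ∈ KZ.relations := by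
  have hσ := s.isSemialgebraic_domain
  have hmeas : MeasurableSet s.domain := KZ.IntegralRep.measurableSet_domain_holds s
  -- a rational constant `K > sup |P|`
  obtain ⟨K₀, hK₀⟩ := exists_bound_aeval (rename (Fin.castAdd k) p) hbd
  have hP : ∀ z ∈ s.domain, |MvPolynomial.aeval (fun i => z (Fin.castAdd k i)) p| ≤ K₀ := fun z hz => by
    have := hK₀ z hz
    simpa [aeval_rename, Function.comp_def] using this
  obtain ⟨K, hK⟩ := exists_rat_gt (max K₀ 0 + 1)
  have hKpos : (0 : ℝ) < K := lt_of_le_of_lt (by positivity) hK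
  -- the shapes
  set D : (Fin (B + 2 + k) → ℝ) → ℝ := fun z =>
    ∏ j, (∑ i, ((L j).1 i : ℝ) * z (Fin.castAdd k i) + ((L j).2 : ℝ)) ^ e j with hD
  set F : (Fin (B + 2 + k) → ℝ) → ℝ := fun z => ∏ i, (a i).elim 1 (fun c => 1 /
    (z (Fin.natAdd (B + 2) i) - (∑ i', (c.1 i' : ℝ) * z (Fin.castAdd k i') + (c.2 : ℝ)))) with hF
  set gK : (Fin (B + 2 + k) → ℝ) → ℝ := fun z =>
    MvPolynomial.aeval (fun i => z (Fin.castAdd k i)) (C K : MvPolynomial (Fin (B + 2)) ℚ) / D z * F z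
    with hgK
  set gP : (Fin (B + 2 + k) → ℝ) → ℝ := fun z =>
    MvPolynomial.aeval (fun i => z (Fin.castAdd k i)) (p + C K) / D z * F z with hgP
  have hgK' : ∀ z, gK z = (K : ℝ) * ((D z)⁻¹ * F z) := fun z => by
    simp only [hgK, MvPolynomial.aeval_C, eq_ratCast]
    ring
  have hgP' : ∀ z ∈ s.domain, gP z = s.integrand z + gK z := fun z hz => by
    rw [hint hz]
    simp only [hgP, hgK, map_add, MvPolynomial.aeval_C, eq_ratCast, hD, hF]
    ring
  -- the two auxiliary representations
  have hIK : IntegrableOn gK s.domain :=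
    IntegrableOn.congr_fun (hfree.const_mul (K : ℝ)) (fun z _ => (hgK' z).symm) hmeas
  let sK : KZ.IntegralRep (B + 2 + k) := ⟨s.domain, gK, hσ, isSemialgebraicFunOn_jj hσ L e _ a, hIK⟩
  have hIP : IntegrableOn gP s.domain :=
    (s.integrableOn.add hIK).congr_fun (fun z hz => (hgP' z hz).symm) hmeas
  let sP : KZ.IntegralRep (B + 2 + k) := ⟨s.domain, gP, hσ, isSemialgebraicFunOn_jj hσ L e _ a, hIP⟩
  have hrel : KZ.of sP - KZ.of s - KZ.of sK ∈ KZ.relations :=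
    KZ.integrandAddRel_subset_relations ⟨_, sP, s, sK, rfl, rfl, fun z hz => hgP' z hz, rfl⟩
  -- both auxiliary numerators are bounded away from zero
  have hnumK : ∃ c : ℝ, 0 < c ∧ ∀ z ∈ sK.domain,
      c ≤ |MvPolynomial.aeval (fun i => z (Fin.castAdd k i)) (C K : MvPolynomial (Fin (B + 2)) ℚ)| :=
    ⟨K, hKpos, fun z _ => by simp [abs_of_pos hKpos]⟩
  have hnumP : ∃ c : ℝ, 0 < c ∧ ∀ z ∈ sP.domain,
      c ≤ |MvPolynomial.aeval (fun i => z (Fin.castAdd k i)) (p + C K)| := by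
    refine ⟨1, one_pos, fun z hz => ?_⟩
    have h1 := hP z hz
    have h2 : K₀ ≤ max K₀ 0 := le_max_left _ _
    rw [map_add, MvPolynomial.aeval_C, eq_ratCast]
    have h3 : |MvPolynomial.aeval (fun i => z (Fin.castAdd k i)) p| ≥
        -(MvPolynomial.aeval (fun i => z (Fin.castAdd k i)) p) := neg_le_abs _
    rw [le_abs]
    left
    linarith
  obtain ⟨cP, hcP, hrP⟩ := separateHigh_fanPos GG hGG B k m m' sP M L e (p + C K) a lo hi
    hbd hdom (fun z _ => rfl) hnumP
  obtain ⟨cK, hcK, hrK⟩ := separateHigh_fanPos GG hGG B k m m' sK M L e (C K) a lo hi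
    hbd hdom (fun z _ => rfl) hnumK
  refine ⟨cP - cK, sub_mem hcP hcK, ?_⟩
  have : KZ.of s - (cP - cK) = (KZ.of sP - cP) - (KZ.of sK - cK) - (KZ.of sP - KZ.of s - KZ.of sK) := by
    abel
  rw [this]
  exact sub_mem (sub_mem hrP hrK) hrel

open SeparatePos SepHigh in
/-- The same, with the target written as `SeparatePos.GGset (B + 1) 1 k`. [Kontsevich–Zagier
2001, §1.2] -/
theorem separateHigh_fanFree_GGset (B k m m' : ℕ) (s : KZ.IntegralRep (B + 2 + k)) (M : Fin m' → (Fin (B + 2) → ℚ) × ℚ) (L : Fin m → (Fin (B + 2) → ℚ) × ℚ) (e : Fin m → ℕ) (p : MvPolynomial (Fin (B + 2)) ℚ) (a : Fin k → Option ((Fin (B + 2) → ℚ) × ℚ)) (lo hi : Fin k → Fin k ⊕ ((Fin (B + 2) → ℚ) × ℚ)) (hbd : Bornology.IsBounded s.domain) (hdom : s.domain = {z | (∀ j, 0 < ∑ i, ((M j).1 i : ℝ) * z (Fin.castAdd k i) + ((M j).2 : ℝ)) ∧ ∀ i, Sum.elim (fun j => z (Fin.natAdd (B + 2) j)) (fun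 c => ∑ i', (c.1 i' : ℝ) * z (Fin.castAdd k i') + (c.2 : ℝ)) (lo i) < z (Fin.natAdd (B + 2) i) ∧ z (Fin.natAdd (B + 2) i) < Sum.elim (fun j => z (Fin.natAdd (B + 2) j)) (fun c => ∑ i', (c.1 i' : ℝ) * z (Fin.castAdd k i') + (c.2 : ℝ)) (hi i)}) (hint : EqOn s.integrand (fun z => MvPolynomial.aeval (fun i => z (Fin.castAdd k i)) p / (∏ j, (∑ i, ((L j).1 i : ℝ) * z (Fin.castAdd k i) + ((L j).2 : ℝ)) ^ e j) * ∏ i, (a i).elim 1 (fun c => 1 / (z (Fin.natAdd (B + 2) i) - (∑ i', (c.1 i' : ℝ) * z (Fin.castAdd k i') + (c.2 : ℝ))))) s.domain) (hfree : IntegrableOn (fun z => (∏ j, (∑ i, ((L j).1 i : ℝ) * z (Fin.castAdd k i) + ((L j).2 : ℝ)) ^ e j)⁻¹ * ∏ i, (a i).elim 1 (fun c => 1 / (z (Fin.natAdd (B + 2) i) - (∑ i', (c.1 i' : ℝ) * z (Fin.castAdd k i') + (c.2 : ℝ))))) s.domain) : ∃ c ∈ AddSubgroup.closure (SeparatePos.GGset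 (B + 1) 1 k), KZ.of s - c ∈ KZ.relations :=
  separateHigh_fanFree GGset (fun _ _ _ => rfl) B k m m' s M L e p a lo hi hbd hdom hint hfree

end Summit.KontsevichZagierPeriods.ArrangementNormalForm.JanusBands
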